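/-
Copyright (c) 2026. All rights reserved.
Released under Apache 2.0 license as described in the file LICENSE.
Authors: abc-iut cell, prover seat abc-iut-L4-d2 (gen 6).
-/
import Literature.AnabelianGeometry.AbsoluteAnabelian.GaloisTheatersNumberFieldShadowContext
import Literature.AnabelianGeometry.AbsoluteAnabelian.GaloisTheatersNumberFieldShadowDecomposition
import Literature.AnabelianGeometry.AbsoluteAnabelian.PanalocalTheatersGeneric
import Literature.AnabelianGeometry.AbsoluteAnabelian.MonoAnalyticLogShellsSubProofs
import Literature.AnabelianGeometry.AbsoluteAnabelian.MLFGaloisTypeProofs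
import Literature.AnabelianGeometry.AbsoluteAnabelian.NumberFieldValuationProSetDecomposition
import Literature.AnabelianGeometry.AbsoluteAnabelian.AbsTopIProp23InfiniteIndexProofs
import HarnessLib

/-!
# [AbsTopIII] Def 5.1 (iv) / Cor 5.2 (v) and Def 5.6 (ii) PROVED at the number-field shadow context:
# panalocalization (F-0182) and mono-analyticization (F-0181)

S. Mochizuki, *Topics in absolute anabelian geometry III* [MochizukiAbsTopIII2015], Def 5.1 (iv) p. 116 / Cor 5.2 (v)
p. 120 (the panalocalization `V✠(Π)` of `V⊚(Π)`) and Def 5.6 (ii) p. 135 (the mono-analyticization, `G_w` "isomorphic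
to the quotient `Π_v ↠ G_v` determined by the absolute Galois group of the base field").  The cell types them as NAMED
`Prop` FACTS over an interface context `R` (`PanalocalTheaters.lean`: `PanalocalizationExists` F-0182,
`MonoAnalyticizationExists` F-0181), with universal closures refuted and GENERIC reductions by abc-iut-f-104
(`PanalocalTheatersGeneric.lean`): `panalocalizationExists_of_mapProVal_mem` (⇐ `Aut(Π)` respects
`{⊚} ∪ V^non ∪ V^arc` through `V⊚(−)`) and `monoAnalyticizationExists_of_isMLFGaloisType` (⇐ every
`G_ṽ = aug(Π_ṽ)`, `ṽ` nonarchimedean, is of MLF-Galois type).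

THIS PROOF-ONLY FILE discharges both side conditions AT `R := NumberFieldShadow.context F`, the `GlobalAnabelianContext`
TERM of the number-field arithmetic shadow (`GaloisTheatersNumberFieldShadowContext.lean`, abc-iut-L4-d2 g6):

* `contextMapProVal_mem_non` / `_mem_arc` — `V⊚(f)` (translation by the conjugator) preserves `V^non`, `V^arc`;
  **`panalocalizationExists_context : PanalocalizationExists (context F)`** (F-0182);
* `ratChart_injective_of_isAdmissible` — the `ℚ`-chart of an ADMISSIBLE `Π_E` is injective: its kernel is a finite
  (it misses an open subgroup), hence topologically finitely generated closed normal subgroup of `Π_E ≅ G_F`, so lies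
  in `Δ_E = 1` by the interface axiom `geom_isMax` ([AbsAnab] Thm 1.1.2, F-0031); `isOpen_range_ratChart_of_isAdmissible`;
* `isMLFGaloisType_decomp_context` — for admissible `Π_E` and nonarchimedean `ṽ`, `Π_{E,ṽ} ≅ D_ṽ ∩ ratChart(Π_E)` is an OPEN
  subgroup of the decomposition group `D_ṽ ⊆ G_ℚ` of the place `ṽ` of `ℚ̄`, which is `≅ Gal(ℚ̄_p/ℚ_p·)` of MLF type
  (abc-iut-f-104's `isMLFGaloisType_decomp_inr_inl` at `F = ℚ`), and open subgroups of MLF-type groups are MLF-type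
  ([AbsTopIII] Prop 5.8 (ii) L01, `Prop58ii.openSubgroup_isMLFGaloisType`); `isMLFGaloisType_galDecomp_context` — so is
  `G_ṽ = aug(Π_{E,ṽ})` (`aug` is bijective at the shadow, abc-iut-f-104's `nonempty_continuousMulEquiv_map_aug`);
  **`monoAnalyticizationExists_context : MonoAnalyticizationExists (context F) ma`** (F-0181), for every archimedean
  mono-analyticization datum `ma`.

HONEST LABEL: «instance PROVED at the number-field SHADOW context» (`Δ = 1`, stub archimedean geometry) — NOT at print's
`EA⊚` of hyperbolic orbicurves (E-L4-13); the rows stay assumptions at the intended model.  F-0183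
(`PanalocalizationMapsHom`) is NOT addressed here.  Classical; nothing here bears on [IUTchIII] Cor. 3.12 or takes a
side; typed ≠ proved elsewhere.
-/

noncomputable section

open scoped Pointwise Topology
open CategoryTheory NumberField Field

namespace Literature.AnabelianGeometry.AbsoluteAnabelian

namespace NumberFieldShadow

variable (F : Type) [Field F] [NumberField F]

/-! ### F-0182: the panalocalization exists -/

/-- `V⊚(f)` maps nonarchimedean elements to nonarchimedean elements. [cite: MochizukiAbsTopIII2015, Def 5.1 (iii) p.115] -/
theorem contextMapProVal_mem_non {E₁ E₂ : FundamentalExtension.{0}} (f : E₁ ⟶ E₂) (hf : IsEAHom f)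
    (v : (contextProVal E₁).carrier) (hv : v ∈ (contextProVal E₁).non) :
    contextMapProVal f hf v ∈ (contextProVal E₂).non := by
  letI := (NumberField.valuationProSet ℚ).action
  change conjugator f hf • (show (NumberField.valuationProSet ℚ).carrier from v) ∈ (NumberField.valuationProSet ℚ).non
  exact (NumberField.valuationProSet ℚ).smul_mem_non _ hv

/-- `V⊚(f)` maps archimedean elements to archimedean elements. [cite: MochizukiAbsTopIII2015, Def 5.1 (iii) p.115] -/
theorem contextMapProVal_mem_arc {E₁ E₂ : FundamentalExtension.{0}} (f : E₁ ⟶ E₂) (hf : IsEAHom f)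
    (v : (contextProVal E₁).carrier) (hv : v ∈ (contextProVal E₁).arc) :
    contextMapProVal f hf v ∈ (contextProVal E₂).arc := by
  letI := (NumberField.valuationProSet ℚ).action
  change conjugator f hf • (show (NumberField.valuationProSet ℚ).carrier from v) ∈ (NumberField.valuationProSet ℚ).arc
  exact (NumberField.valuationProSet ℚ).smul_mem_arc _ hv

/-- **Def 5.1 (iv) / Cor 5.2 (v), object part (F-0182), PROVED at the number-field shadow context**: for every
admissible `Π`, the panalocalization `V✠(Π)` of `V⊚(Π)` exists (underlying set `V⊚(Π)/Aut(Π)`; `Aut(Π)` acts on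
`V⊚(ℚ̄/ℚ)` through conjugators, i.e. by Galois translations, which respect `{⊚} ∪ V^non ∪ V^arc`).
[cite: MochizukiAbsTopIII2015, Cor 5.2 (v) p.120] -/
theorem panalocalizationExists_context : PanalocalizationExists (context F) :=
  panalocalizationExists_of_mapProVal_mem (context F) (fun _ _ α hα => contextMapProVal_generic α.hom hα)
    (fun _ _ α hα v hv => contextMapProVal_mem_non α.hom hα v hv)
    (fun _ _ α hα v hv => contextMapProVal_mem_arc α.hom hα v hv)

/-! ### The `ℚ`-chart of an admissible `Π` is injective with open range -/

/-- **The `ℚ`-chart of an ADMISSIBLE `Π_E` is injective**: its kernel misses an open subgroup, so is finite, hence a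
topologically finitely generated closed normal subgroup of `Π_E`, which lies in `Δ_E` by the interface axiom
`geom_isMax` ([AbsAnab] Thm 1.1.2 at `G_F`) — and `Δ_E = 1` at the shadow. [cite: MochizukiAbsAnab2004, Thm 1.1.2 p.6] -/
theorem ratChart_injective_of_isAdmissible {E : FundamentalExtension.{0}} (hE : IsAdmissible F E) :
    Function.Injective (ratChart E) := by
  obtain ⟨W, hW, hinj, -⟩ := ratChart_spec (hasRatChart_of_isAdmissible F hE)
  let K : Subgroup E.arith := (ratChart E).toMonoidHom.ker
  -- `K ∩ W = 1`
  have hKW : ∀ x ∈ K, x ∈ W → x = 1 := fun x hx hxW =>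
    hinj hxW W.one_mem (by rw [map_one]; exact hx)
  -- `K` is finite: it injects into the finite coset space `Π / W`
  haveI : Finite (E.arith ⧸ W) := Subgroup.quotient_finite_of_isOpen W hW
  have hKfin : Finite K := by
    refine Finite.of_injective (fun x : K => (QuotientGroup.mk (x : E.arith) : E.arith ⧸ W)) ?_
    intro a b hab
    have hmemW : (a : E.arith)⁻¹ * b ∈ W := QuotientGroup.eq.mp hab
    have hmemK : (a : E.arith)⁻¹ * b ∈ K := K.mul_mem (K.inv_mem a.2) b.2
    exact Subtype.ext (inv_mul_eq_one.mp (hKW _ hmemK hmemW))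
  -- `K` is closed, normal and topologically finitely generated, hence `≤ Δ_E = ⊥`
  have hKc : IsClosed (K : Set E.arith) := by
    change IsClosed ((ratChart E) ⁻¹' {1})
    exact isClosed_singleton.preimage (ratChart E).continuous
  haveI : K.Normal := MonoidHom.normal_ker _
  haveI : Finite K := hKfin
  have htfg : IsTopologicallyFinitelyGenerated K := FundamentalExtension.isTopologicallyFinitelyGenerated_of_finite
  have hle : K ≤ E.geom := (isMaxTopFGClosedNormal_geom_of_isAdmissible F hE).maximal K inferInstance hKc htfg
  rw [geom_eq_bot_of_isAdmissible F hE, le_bot_iff] at hle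
  exact (MonoidHom.ker_eq_bot_iff _).mp hle

/-- The range of the `ℚ`-chart of an admissible `Π_E` is an OPEN subgroup of `G_ℚ` (it contains the open image of the
chart's open subgroup). [cite: MochizukiAbsTopIII2015, Def 5.1 (iii) p.115] -/
theorem isOpen_range_ratChart_of_isAdmissible {E : FundamentalExtension.{0}} (hE : IsAdmissible F E) :
    IsOpen (((ratChart E).toMonoidHom.range : Subgroup (absoluteGaloisGroup ℚ)) : Set (absoluteGaloisGroup ℚ)) := by
  obtain ⟨W, _, _, hop⟩ := ratChart_spec (hasRatChart_of_isAdmissible F hE)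
  refine Subgroup.isOpen_mono (H₁ := W.map (ratChart E).toMonoidHom) ?_ (by rw [Subgroup.coe_map]; exact hop)
  rintro _ ⟨w, -, rfl⟩
  exact ⟨w, rfl⟩

/-! ### F-0181: decomposition groups at the shadow context are of MLF-Galois type -/

/-- **`Π_{E,ṽ}` is of MLF-Galois type** for admissible `Π_E` and nonarchimedean `ṽ ∈ V⊚(Π_E)`: through the (injective)
`ℚ`-chart, `Π_{E,ṽ} ≅ D_ṽ ∩ ratChart(Π_E)`, an OPEN subgroup of the decomposition group `D_ṽ ⊆ G_ℚ` of the place `ṽ` of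
`ℚ̄` — itself the absolute Galois group of a `p`-adic field — and open subgroups of MLF-type groups are MLF-type
(Prop 5.8 (ii) L01). [cite: MochizukiAbsTopIII2015, Def 5.6 (ii) p.135] -/
theorem isMLFGaloisType_decomp_context {E : FundamentalExtension.{0}} (hE : IsAdmissible F E)
    (v : (contextProVal E).carrier) (hv : v ∈ (contextProVal E).non)
    (hclosed : IsClosed (((contextProVal E).decomp v : Subgroup E.arith) : Set E.arith)) :
    IsMLFGaloisType (ProfiniteGrp.ofClosedSubgroup (G := E.arith) ⟨(contextProVal E).decomp v, hclosed⟩) := by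
  obtain ⟨A, rfl⟩ : v ∈ Set.range (fun A : NumberFieldValuationProSet.NonArch ℚ =>
      (Sum.inr (Sum.inl A) : NumberFieldValuationProSet.Carrier ℚ)) := hv
  have hinj := ratChart_injective_of_isAdmissible F hE
  set m := ratChart E with hm
  -- the decomposition group `D` of the place in `G_ℚ`, as a profinite group of MLF type
  let Dsub : Subgroup (absoluteGaloisGroup ℚ) := (NumberField.valuationProSet ℚ).decomp (Sum.inr (Sum.inl A))
  have hDc : IsClosed (Dsub : Set (absoluteGaloisGroup ℚ)) := (NumberField.valuationProSet ℚ).isClosed_decomp _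
  let D : ProfiniteGrp.{0} := ProfiniteGrp.ofClosedSubgroup (G := absoluteGaloisGrp ℚ) ⟨Dsub, hDc⟩
  have hD : IsMLFGaloisType D := NumberFieldValuationProSet.isMLFGaloisType_decomp_inr_inl ℚ A
  -- the open subgroup `D ∩ range m` of `D`
  have hRo := isOpen_range_ratChart_of_isAdmissible F hE
  let U : OpenSubgroup D :=
    ⟨(m.toMonoidHom.range).comap Dsub.subtype,
      hRo.preimage continuous_subtype_val⟩
  have hU : IsMLFGaloisType (ProfiniteGrp.ofClosedSubgroup ⟨U.toSubgroup, U.isClosed⟩) :=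
    Prop58ii.openSubgroup_isMLFGaloisType D hD U
  -- `Π_{E,ṽ} = m⁻¹(D) ≅ D ∩ range m`
  have hmem : ∀ g : E.arith, g ∈ (contextProVal E).decomp (Sum.inr (Sum.inl A)) ↔ m g ∈ Dsub := by
    intro g
    change g ∈ ((NumberField.valuationProSet ℚ).comap (ratChart E)).decomp _ ↔ _
    rw [GaloisProSet.decomp_comap, Subgroup.mem_comap]
    rfl
  haveI : CompactSpace ((contextProVal E).decomp (Sum.inr (Sum.inl A))) :=
    isCompact_iff_compactSpace.mp hclosed.isCompact
  let r : (contextProVal E).decomp (Sum.inr (Sum.inl A)) →* U.toSubgroup :=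
    { toFun := fun g => ⟨⟨m g, (hmem g).mp g.2⟩, ⟨g, rfl⟩⟩
      map_one' := Subtype.ext (Subtype.ext (map_one m))
      map_mul' := fun a b => Subtype.ext (Subtype.ext (map_mul m (a : E.arith) (b : E.arith))) }
  have hrbij : Function.Bijective r := by
    refine ⟨fun a b h => Subtype.ext (hinj ?_), fun u => ?_⟩
    · exact congrArg (fun x : U.toSubgroup => x.1.1) h
    · obtain ⟨⟨d, hd⟩, ⟨g, hg⟩⟩ := u
      have hg' : m g = d := hg
      refine ⟨⟨g, (hmem g).mpr (hg' ▸ hd)⟩, Subtype.ext (Subtype.ext hg')⟩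
  let e₀ := MulEquiv.ofBijective r hrbij
  have hc : Continuous e₀ := by
    refine Continuous.subtype_mk (Continuous.subtype_mk ?_ _) _
    exact m.continuous.comp continuous_subtype_val
  let e : (contextProVal E).decomp (Sum.inr (Sum.inl A)) ≃ₜ* U.toSubgroup :=
    { e₀ with
      continuous_toFun := hc
      continuous_invFun := Continuous.continuous_symm_of_equiv_compact_to_t2 (f := e₀.toEquiv) hc }
  exact IsMLFGaloisType.of_continuousMulEquiv hU e

/-- **`G_ṽ = aug(Π_{E,ṽ})` is of MLF-Galois type** for admissible `Π_E` and nonarchimedean `ṽ` (at the shadow `aug` is a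
bijection, so `aug(Π_{E,ṽ}) ≅ Π_{E,ṽ}`) — the hypothesis of `monoAnalyticizationExists_of_isMLFGaloisType`, with ANY
closedness witness. [cite: MochizukiAbsTopIII2015, Def 5.6 (ii) p.135] -/
theorem isMLFGaloisType_galDecomp_context {E : FundamentalExtension.{0}} (hE : IsAdmissible F E)
    (v : (contextProVal E).carrier) (hv : v ∈ (contextProVal E).non)
    (hclosed : IsClosed ((((contextProVal E).decomp v).map E.aug.toMonoidHom : Subgroup E.gal) : Set E.gal)) :
    IsMLFGaloisType (ProfiniteGrp.ofClosedSubgroup (G := E.gal)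
      ⟨((contextProVal E).decomp v).map E.aug.toMonoidHom, hclosed⟩) := by
  obtain ⟨e⟩ := nonempty_continuousMulEquiv_map_aug F hE ((contextProVal E).decomp v)
    ((contextProVal E).isClosed_decomp v)
  exact IsMLFGaloisType.of_continuousMulEquiv
    (isMLFGaloisType_decomp_context F hE v hv ((contextProVal E).isClosed_decomp v)) e.symm

/-- **Def 5.6 (ii) (F-0181), PROVED at the number-field shadow context**: every panalocal Galois-theater over
`NumberFieldShadow.context F` admits a mono-analyticization, for every archimedean mono-analyticization datum `ma`.
[cite: MochizukiAbsTopIII2015, Def 5.6 (ii) p.135] -/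
theorem monoAnalyticizationExists_context (ma : ArchMonoAnalyticization.{0}) :
    MonoAnalyticizationExists (context F) ma :=
  monoAnalyticizationExists_of_isMLFGaloisType (context F) ma fun _ hE v hv =>
    isMLFGaloisType_galDecomp_context F hE v hv _

end NumberFieldShadow

end Literature.AnabelianGeometry.AbsoluteAnabelian

end
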